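import Summits.NavierStokesRegularity.FluidComputer.AngularGalerkinLadder
import Literature.Analysis.FluidPDE.LeraySelfSimilarCalculus

/-!
# The Leray line of the angular Galerkin ladder: a band-limited self-similar profile with
# co-band-limited defect IS a singular rung (`RungIsSingular L`) — the positive bridge

Circuit seat (ns-blowup-circuit g10), route-independent kernel tools `--supports` crux K1
`RungBlowupCofinal` (stmt-NavierStokesRegularity-19959) of route `AngularGalerkinLadder`; no
definition, no named fact, nothing asserted about any concrete profile.

## Why

K1 asks, cofinally in `L`, for a NONTRIVIAL Type-I rotated-DSS ancient rung profile
(`AngularLadder.RungIsSingular L`). The cheapest candidates are EXACTLY self-similar (Leray-type)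
rung profiles `u(t,x) = (−t)^{-1/2} U(x/√−t)`: the cell's MODEL line «Z2-OCT / OCT-P93» holds a
float64 root of the `O_h`-symmetric poloidal similarity ODE of `NS₄` reproduced on two codes, and an
ℓ-ladder to rungs 6 and 8. This file types, once and for all, WHAT SUCH A ROOT OWES to become an
instance of K1 at its rung — and proves that nothing else is owed:

`rungIsSingular_of_lerayProfile`: a smooth profile `U : ℝ³ → ℝ³` with smooth pressure `P` and a
defect `D` such that
* (steady Leray system with defect, `ν = 1`, rate `a = ½`)
  `−ΔU + ½U + ½(y·∇)U + (U·∇)U + ∇P = D` pointwise, `div U = 0`;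
* (the rung) `U` is band-limited to degree `≤ L` (`IsBandLimited L U`: the Casimir cut) and `D` is
  co-band-limited (`IsCobandLimited L D`);
* (Type I) `‖U(y)‖ ≤ C/(‖y‖ + 1)`;
* (non-triviality) `U ≢ 0`,
yields `RungIsSingular L`, via `u = lerayBackward ½ 0 U`, `p = lerayBackwardPressure ½ 0 P`,
`d(t,x) = (−t)^{-3/2} D(x/√−t)`: a classical forced rung solution on `(−∞,0)` (the FORCED Leray
reduction `isClassicalNSSolutionOn_lerayBackward_forced`, every term `λ³` times the profile term,
on the tree's `LeraySelfSimilarCalculus`), band-limited slices (the Casimir cut COMMUTES WITH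
DILATIONS: `angGen_smul_comp_smul`, `casimir_smul_comp_smul`, `bandDefect_smul_comp_smul`,
`isBandLimited_smul_comp_smul`), co-band-limited force slices (`isCobandLimited_smul_comp_smul`,
Haar change of variables), `2`-DSS with the trivial rotation (self-similar), and Type-I with the
SAME constant `C` (`‖u(t,x)‖ = λ‖U(λx)‖ ≤ C/(‖x‖ + √−t)` exactly).

`isWindowProfile_of_lerayProfile`: with, in addition, `δ ≤ ‖U(x₀)‖` somewhere and
`‖D(y)‖ ≤ ε/(‖y‖ + 1)³`, the same triple is a WINDOW profile
(`IsWindowProfile L C cmin cmax δ ε c 1 …`) for EVERY factor `c ∈ [cmin, cmax]`, `1 < c` — the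
dictionary «Type-I constant `C = sup (‖y‖+1)‖U‖`, floor `δ`, defect size
`ε = sup (‖y‖+1)³‖D‖`» in which the companion Negative file
`NoOverheating/Negative/SelfSimilarWindowsExcluded.lean` states the Leray-line law (such
profiles can never populate K2's windows with `ε_L → 0`).

LABEL: KERNEL (calculus). WHAT THIS IS NOT: not NS, and not a K1 instance — no profile `U` is
constructed here; OCT-P93 is a MODEL float64 object; turning it into the hypotheses of
`rungIsSingular_of_lerayProfile` needs (i) a certified root of the reduced ODE, (ii) the typed
derivation «`O_h` poloidal line of `NS₄` ⇒ that ODE» (band-limitedness of the ansatz and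
co-band-limitedness of its defect included), (iii) the decay `‖U(y)‖ ≤ C/(‖y‖+1)` — none of
which is claimed.
References: [cite: Leray1934, §20 (3.11)–(3.12)]; [cite: NecasRuzickaSverak1996, (1.3)–(1.5)];
[cite: KochNadirashviliSereginSverak2009, (1.6)]; [cite: ChaeWolf2017RemovingDSS, Def. 1.1];
[cite: BullardGellman1954] (vector spherical harmonics / isotypic cut).
-/

noncomputable section

namespace Summit.NavierStokesRegularity.AngularGalerkinLadderLerayLine

open Set MeasureTheory Filter Topology Function
open scoped Laplacian RealInnerProductSpace ContDiff
open Literature.Analysis.FluidPDE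
open Summit.NavierStokesRegularity.FluidComputer
open Summit.NavierStokesRegularity.FluidComputer.AngularLadder

/-! ### §1 The Casimir cut commutes with dilations `x ↦ s • U (b • x)` -/

/-- `a × (s • v) = s • (a × v)` (linearity of the tree's `crossCLM`). [folklore] -/
private theorem cross_smul_right' (a v : EuclideanSpace ℝ (Fin 3)) (s : ℝ) : cross a (s • v) = s • cross a v := by
  rw [← crossCLM_apply, ← crossCLM_apply, map_smul]

/-- **The rotation generators commute with dilations**: for `V(x) = s • U(b x)`,
`(J_a V)(x) = s • (J_a U)(b x)` (`DV(x) = (s b) • DU(b x)`, no differentiability needed, and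
`e_a × (b x) = b (e_a × x)`). [folklore] -/
theorem angGen_smul_comp_smul (i : Fin 3) (U : EuclideanSpace ℝ (Fin 3) → EuclideanSpace ℝ (Fin 3)) (s b : ℝ) (x : EuclideanSpace ℝ (Fin 3)) :
    angGen i (fun y => s • U (b • y)) x = s • angGen i U (b • x) := by
  simp only [angGen]
  rw [fderiv_const_smul_comp_smul' U s b x, cross_smul_right', cross_smul_right',
    FunLike.coe_smul, Pi.smul_apply, map_smul, smul_sub, smul_smul]

/-- **The Casimir operator commutes with dilations**: `𝒞(s • U(b ·))(x) = s • (𝒞U)(b x)`. [folklore] -/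
theorem casimir_smul_comp_smul (U : EuclideanSpace ℝ (Fin 3) → EuclideanSpace ℝ (Fin 3)) (s b : ℝ) (x : EuclideanSpace ℝ (Fin 3)) :
    casimir (fun y => s • U (b • y)) x = s • casimir U (b • x) := by
  simp only [casimir]
  have h : ∀ i : Fin 3,
      angGen i (angGen i (fun y => s • U (b • y))) x = s • angGen i (angGen i U) (b • x) := by
    intro i
    have h1 : angGen i (fun y => s • U (b • y)) = fun y => s • angGen i U (b • y) :=
      funext (angGen_smul_comp_smul i U s b)
    rw [h1, angGen_smul_comp_smul]
  simp only [h, ← Finset.smul_sum, smul_neg]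

/-- **The band defect `∏_{j ≤ L}(𝒞 − j(j+1))` commutes with dilations.** [folklore] -/
theorem bandDefect_smul_comp_smul (L : ℕ) (U : EuclideanSpace ℝ (Fin 3) → EuclideanSpace ℝ (Fin 3)) (s b : ℝ) :
    bandDefect L (fun y => s • U (b • y)) = fun x => s • bandDefect L U (b • x) := by
  induction L with
  | zero =>
      funext x
      exact casimir_smul_comp_smul U s b x
  | succ L ih =>
      funext x
      simp only [bandDefect]
      rw [ih, casimir_smul_comp_smul]
      rw [smul_sub, smul_comm (((L : ℝ) + 1) * ((L : ℝ) + 2)) s]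

/-- **Band-limitedness is dilation invariant**: if `U` is band-limited to degree `≤ L` about the
origin then so is `x ↦ s • U(b x)` (in particular every slice `λ(t) U(λ(t) x)` of a Leray-type
field). [cite: BullardGellman1954] -/
theorem isBandLimited_smul_comp_smul {L : ℕ} {U : EuclideanSpace ℝ (Fin 3) → EuclideanSpace ℝ (Fin 3)} (h : IsBandLimited L U) (s b : ℝ) :
    IsBandLimited L (fun y => s • U (b • y)) := by
  refine ⟨(h.1.comp (contDiff_id.const_smul b)).const_smul s, fun x => ?_⟩
  rw [bandDefect_smul_comp_smul]
  show s • bandDefect L U (b • x) = 0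
  rw [h.2, smul_zero]

/-- **Co-band-limitedness is dilation invariant** (`b ≠ 0`): if `D` is `L²`-orthogonal to every
compactly supported band-limited test field, so is `x ↦ s • D(b x)` — test against
`y ↦ ψ(b⁻¹ y)` (band-limited and compactly supported again) after the Haar change of variables
`∫ g(b x) dx = |b|⁻³ ∫ g`. [folklore] -/
theorem isCobandLimited_smul_comp_smul {L : ℕ} {D : EuclideanSpace ℝ (Fin 3) → EuclideanSpace ℝ (Fin 3)} (h : IsCobandLimited L D)
    (s b : ℝ) (hb : b ≠ 0) : IsCobandLimited L (fun y => s • D (b • y)) := by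
  intro ψ hψ hsupp
  set ψ' : EuclideanSpace ℝ (Fin 3) → EuclideanSpace ℝ (Fin 3) := fun y => ψ (b⁻¹ • y) with hψ'def
  have hψ' : IsBandLimited L ψ' := by
    have := isBandLimited_smul_comp_smul hψ 1 b⁻¹
    simpa only [one_smul] using this
  have hsupp' : HasCompactSupport ψ' := hsupp.comp_smul (inv_ne_zero hb)
  have h1 : (fun x => ⟪s • D (b • x), ψ x⟫) = fun x => s * (fun y => ⟪D y, ψ' y⟫) (b • x) := by
    funext x
    rw [real_inner_smul_left]
    simp only [hψ'def, smul_smul, inv_mul_cancel₀ hb, one_smul]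
  rw [h1, integral_const_mul, Measure.integral_comp_smul volume (fun y => ⟪D y, ψ' y⟫) b,
    h ψ' hψ' hsupp', smul_zero, mul_zero]

/-! ### §2 The FORCED Leray reduction -/

section Forced

variable {ν a T : ℝ} {U D : EuclideanSpace ℝ (Fin 3) → EuclideanSpace ℝ (Fin 3)} {P : EuclideanSpace ℝ (Fin 3) → ℝ}

/-- **Forced Leray reduction** (Leray 1934, §20, with a defect): if `U ∈ C^∞`, `P ∈ C^∞` and
`−νΔU + aU + a(y·∇)U + (U·∇)U + ∇P = D` pointwise with `div U = 0`, then below the blow-up time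
`T` the backward ansatz `u = λ(t)U(λ(t)x)`, `p = λ(t)²P(λ(t)x)`, `λ(t) = (2a(T−t))^{-1/2}`, is a
classical Navier–Stokes solution FORCED by `d(t,x) = λ(t)³ D(λ(t)x)` on `(−∞, T) × ℝ³` (every
term of the momentum equation is `λ³` times the corresponding profile term at `y = λx`, by
`λ' = aλ³`; all slice identities from the tree's `LeraySelfSimilarCalculus`). [cite: Leray1934, §20 (3.11)–(3.12)] -/
theorem isClassicalNSSolutionOn_lerayBackward_forced (ha : 0 < a) (hU : ContDiff ℝ ∞ U)
    (hP : ContDiff ℝ ∞ P)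
    (heq : ∀ y, -(ν • (Δ U) y) + a • U y + a • fderiv ℝ U y y + convect U U y + gradient P y = D y)
    (hdiv : VectorCalculus.IsDivFree U) :
    IsClassicalNSSolutionOn (Iio T) ν
      (fun t x => ((Real.sqrt (2 * a * (T - t)))⁻¹) ^ 3 • D ((Real.sqrt (2 * a * (T - t)))⁻¹ • x))
      (lerayBackward a T U) (lerayBackwardPressure a T P) := by
  have hU1 : ContDiff ℝ 1 U := hU.of_le (by norm_cast)
  have hU2 : ContDiff ℝ 2 U := hU.of_le (by norm_cast)
  have hsu : IsSmoothSpaceTimeOn (Iio T) (lerayBackward a T U) :=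
    contDiffOn_uncurry_lerayBackward ha hU T
  have hsp : IsSmoothSpaceTimeOn (Iio T) (lerayBackwardPressure a T P) := by
    show ContDiffOn ℝ ∞ (uncurry (lerayBackwardPressure a T P)) (Iio T ×ˢ univ)
    refine (contDiffOn_uncurry_lerayBackwardPressure_sub ha hP T 0).congr ?_
    rintro ⟨t, x⟩ hz
    have ht : t < T := hz.1
    simp only [uncurry_apply_pair, lerayBackwardPressure_eq_of_lt ha ht P]
  refine ⟨hsu, hsp, fun t ht x => ?_, fun t _ => isDivFree_lerayBackward hdiv a T t⟩
  have ht' : t < T := ht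
  have hint : t ∈ interior (Iio T) := by rwa [interior_Iio]
  rw [timeDerivWithin_of_mem_interior hint x, lerayBackwardPressure_eq_of_lt ha ht' P]
  set Λ : ℝ := (Real.sqrt (2 * a * (T - t)))⁻¹ with hΛ
  set y : EuclideanSpace ℝ (Fin 3) := Λ • x with hy
  rw [timeDeriv_lerayBackward ha ht' hU1 x, convect_lerayBackward, laplacian_lerayBackward hU2,
    gradient_lerayBackwardPressure_sub]
  simp only [← hΛ, ← hy]
  rw [← heq y]
  module

end Forced

/-! ### §3 Leray-type band-limited profiles are singular rungs -/

/-- The scale factor of `lerayBackward ½ 0`: `λ(t) = (√(−t))⁻¹`. [folklore] -/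
private theorem scale_half_zero (t : ℝ) :
    (Real.sqrt (2 * (1 / 2 : ℝ) * (0 - t)))⁻¹ = (Real.sqrt (-t))⁻¹ := by
  norm_num

/-- **A Leray-type band-limited profile with co-band-limited defect is a singular rung.** For
`U, P ∈ C^∞`, `D` with `−ΔU + ½U + ½(y·∇)U + (U·∇)U + ∇P = D`, `div U = 0`, `U` band-limited to
degree `≤ L`, `D` co-band-limited, `‖U(y)‖ ≤ C/(‖y‖+1)` and `U ≢ 0`: `RungIsSingular L`, witnessed
by `u = lerayBackward ½ 0 U` (`= (−t)^{-1/2}U(x/√−t)`), `p = lerayBackwardPressure ½ 0 P`,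
`d(t,x) = (−t)^{-3/2}D(x/√−t)`, DSS factor `2`, rotation `1`, Type-I constant `C`.
[cite: NecasRuzickaSverak1996, (1.3)–(1.5)] [cite: KochNadirashviliSereginSverak2009, (1.6)]
[cite: ChaeWolf2017RemovingDSS, Def. 1.1] -/
theorem rungIsSingular_of_lerayProfile {L : ℕ} {C : ℝ} {U D : EuclideanSpace ℝ (Fin 3) → EuclideanSpace ℝ (Fin 3)} {P : EuclideanSpace ℝ (Fin 3) → ℝ}
    (hU : ContDiff ℝ ∞ U) (hP : ContDiff ℝ ∞ P)
    (heq : ∀ y, -((Δ U) y) + (1 / 2 : ℝ) • U y + (1 / 2 : ℝ) • fderiv ℝ U y y + convect U U y +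
      gradient P y = D y)
    (hdiv : VectorCalculus.IsDivFree U) (hband : IsBandLimited L U) (hcob : IsCobandLimited L D)
    (hdec : ∀ y, ‖U y‖ ≤ C / (‖y‖ + 1)) (hne : ∃ y, U y ≠ 0) :
    RungIsSingular L := by
  have ha : (0 : ℝ) < 1 / 2 := by norm_num
  set u := lerayBackward (1 / 2 : ℝ) 0 U with hudef
  set p := lerayBackwardPressure (1 / 2 : ℝ) 0 P with hpdef
  set d : ℝ → EuclideanSpace ℝ (Fin 3) → EuclideanSpace ℝ (Fin 3) := fun t x => ((Real.sqrt (2 * (1 / 2 : ℝ) * (0 - t)))⁻¹) ^ 3 •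
    D ((Real.sqrt (2 * (1 / 2 : ℝ) * (0 - t)))⁻¹ • x) with hddef
  -- (1) classical forced rung solution on `(−∞, 0)`
  have heq' : ∀ y, -((1 : ℝ) • (Δ U) y) + (1 / 2 : ℝ) • U y + (1 / 2 : ℝ) • fderiv ℝ U y y +
      convect U U y + gradient P y = D y := fun y => by
    rw [one_smul]; exact heq y
  have hcl : IsClassicalNSSolutionOn (Iio 0) 1 d u p :=
    isClassicalNSSolutionOn_lerayBackward_forced (T := 0) ha hU hP heq' hdiv
  -- (2) band-limited velocity slices, co-band-limited force slices
  have hbl : ∀ t ∈ Iio (0 : ℝ), IsBandLimited L (u t) := fun t _ => by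
    have hslice : u t = fun x => (Real.sqrt (2 * (1 / 2 : ℝ) * (0 - t)))⁻¹ •
        U ((Real.sqrt (2 * (1 / 2 : ℝ) * (0 - t)))⁻¹ • x) := by
      funext x; rfl
    rw [hslice]
    exact isBandLimited_smul_comp_smul hband _ _
  have hcb : ∀ t ∈ Iio (0 : ℝ), IsCobandLimited L (d t) := fun t ht => by
    have hΛ : (Real.sqrt (2 * (1 / 2 : ℝ) * (0 - t)))⁻¹ ≠ 0 := (lerayScale_pos ha ht).ne'
    exact isCobandLimited_smul_comp_smul hcob _ _ hΛ
  -- (3) DSS with factor 2 and trivial rotation (the field is self-similar)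
  have hdss : IsRotatedDSS 2 (LinearIsometryEquiv.refl ℝ (EuclideanSpace ℝ (Fin 3))) u :=
    isRotatedDSS_refl_iff.2 ((isSelfSimilar_lerayBackward_zero (1 / 2 : ℝ) U).isDiscretelySelfSimilar
      two_pos)
  -- (4) Type-I with the same constant
  have hTI : HasTypeIDecay C u := by
    intro t ht x
    have hσ : 0 < Real.sqrt (-t) := Real.sqrt_pos.2 (by linarith)
    have hσne : Real.sqrt (-t) ≠ 0 := hσ.ne'
    have hΛpos : 0 < (Real.sqrt (-t))⁻¹ := inv_pos.2 hσ
    have hux : u t x = (Real.sqrt (-t))⁻¹ • U ((Real.sqrt (-t))⁻¹ • x) := by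
      show lerayBackward (1 / 2 : ℝ) 0 U t x = _
      rw [lerayBackward_apply, scale_half_zero]
    rw [hux, norm_smul, Real.norm_eq_abs, abs_of_pos hΛpos]
    have h1 := hdec ((Real.sqrt (-t))⁻¹ • x)
    rw [norm_smul, Real.norm_eq_abs, abs_of_pos hΛpos] at h1
    have hC : 0 ≤ C := by
      have h0 := (norm_nonneg _).trans (hdec 0)
      simpa using h0
    calc (Real.sqrt (-t))⁻¹ * ‖U ((Real.sqrt (-t))⁻¹ • x)‖
        ≤ (Real.sqrt (-t))⁻¹ * (C / ((Real.sqrt (-t))⁻¹ * ‖x‖ + 1)) :=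
          mul_le_mul_of_nonneg_left h1 hΛpos.le
      _ = C / (‖x‖ + Real.sqrt (-t)) := by
          field_simp
  -- (5) non-triviality at `t = −1`, where `λ = 1` and `u(−1) = U`
  have hu1 : u (-1) = U := by
    have h := lerayBackward_apply_sub_inv ha 0 U
    norm_num at h
    exact h
  obtain ⟨y, hy⟩ := hne
  exact ⟨C, 2, LinearIsometryEquiv.refl ℝ (EuclideanSpace ℝ (Fin 3)), u, p, d, ⟨⟨hcl, hbl, hcb⟩, one_lt_two, hdss, hTI⟩,
    -1, by norm_num, y, by rwa [hu1]⟩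

/-! ### §4 The window dictionary of a Leray-type profile -/

/-- **Window profile of a Leray-type band-limited profile.** Under the hypotheses of
`rungIsSingular_of_lerayProfile` plus an amplitude floor `δ ≤ ‖U(x₀)‖` and the defect decay
`‖D(y)‖ ≤ ε/(‖y‖+1)³`, the triple `(u, p, d)` above is a WINDOW profile
`IsWindowProfile L C cmin cmax δ ε c 1 u p d` for every factor `c ∈ [cmin, cmax]` with `1 < c`:
Type-I constant `C`, floor `δ` at `t = −1` (where `u(−1) = U`), defect size `ε`
(`‖d(t,x)‖ = λ³‖D(λx)‖ ≤ ε/(‖x‖+√−t)³` exactly). This is the (constant, floor, defect-size)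
dictionary in which `NoOverheating/Negative/SelfSimilarWindowsExcluded` forbids `ε → 0` along any
sequence of such profiles with `C`, `δ` fixed. [cite: KochNadirashviliSereginSverak2009, (1.6)] -/
theorem isWindowProfile_of_lerayProfile {L : ℕ} {C δ ε c cmin cmax : ℝ} {U D : EuclideanSpace ℝ (Fin 3) → EuclideanSpace ℝ (Fin 3)}
    {P : EuclideanSpace ℝ (Fin 3) → ℝ} (hU : ContDiff ℝ ∞ U) (hP : ContDiff ℝ ∞ P)
    (heq : ∀ y, -((Δ U) y) + (1 / 2 : ℝ) • U y + (1 / 2 : ℝ) • fderiv ℝ U y y + convect U U y +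
      gradient P y = D y)
    (hdiv : VectorCalculus.IsDivFree U) (hband : IsBandLimited L U) (hcob : IsCobandLimited L D)
    (hdec : ∀ y, ‖U y‖ ≤ C / (‖y‖ + 1)) (hamp : ∃ y, δ ≤ ‖U y‖)
    (hdef : ∀ y, ‖D y‖ ≤ ε / (‖y‖ + 1) ^ 3) (hc : 1 < c) (hcmin : cmin ≤ c) (hcmax : c ≤ cmax) :
    IsWindowProfile L C cmin cmax δ ε c (LinearIsometryEquiv.refl ℝ (EuclideanSpace ℝ (Fin 3)))
      (lerayBackward (1 / 2 : ℝ) 0 U) (lerayBackwardPressure (1 / 2 : ℝ) 0 P)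
      (fun t x => ((Real.sqrt (2 * (1 / 2 : ℝ) * (0 - t)))⁻¹) ^ 3 •
        D ((Real.sqrt (2 * (1 / 2 : ℝ) * (0 - t)))⁻¹ • x)) := by
  have ha : (0 : ℝ) < 1 / 2 := by norm_num
  set u := lerayBackward (1 / 2 : ℝ) 0 U with hudef
  set p := lerayBackwardPressure (1 / 2 : ℝ) 0 P with hpdef
  set d : ℝ → EuclideanSpace ℝ (Fin 3) → EuclideanSpace ℝ (Fin 3) := fun t x => ((Real.sqrt (2 * (1 / 2 : ℝ) * (0 - t)))⁻¹) ^ 3 •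
    D ((Real.sqrt (2 * (1 / 2 : ℝ) * (0 - t)))⁻¹ • x) with hddef
  -- the rung-profile part: reuse the singular-rung construction clause by clause
  have heq' : ∀ y, -((1 : ℝ) • (Δ U) y) + (1 / 2 : ℝ) • U y + (1 / 2 : ℝ) • fderiv ℝ U y y +
      convect U U y + gradient P y = D y := fun y => by
    rw [one_smul]; exact heq y
  have hcl : IsClassicalNSSolutionOn (Iio 0) 1 d u p :=
    isClassicalNSSolutionOn_lerayBackward_forced (T := 0) ha hU hP heq' hdiv
  have hbl : ∀ t ∈ Iio (0 : ℝ), IsBandLimited L (u t) := fun t _ => by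
    have hslice : u t = fun x => (Real.sqrt (2 * (1 / 2 : ℝ) * (0 - t)))⁻¹ •
        U ((Real.sqrt (2 * (1 / 2 : ℝ) * (0 - t)))⁻¹ • x) := by
      funext x; rfl
    rw [hslice]
    exact isBandLimited_smul_comp_smul hband _ _
  have hcb : ∀ t ∈ Iio (0 : ℝ), IsCobandLimited L (d t) := fun t ht => by
    have hΛ : (Real.sqrt (2 * (1 / 2 : ℝ) * (0 - t)))⁻¹ ≠ 0 := (lerayScale_pos ha ht).ne'
    exact isCobandLimited_smul_comp_smul hcob _ _ hΛ
  have hdss : IsRotatedDSS c (LinearIsometryEquiv.refl ℝ (EuclideanSpace ℝ (Fin 3))) u :=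
    isRotatedDSS_refl_iff.2 ((isSelfSimilar_lerayBackward_zero (1 / 2 : ℝ) U).isDiscretelySelfSimilar
      (by linarith))
  have hC : 0 ≤ C := by
    have h0 := (norm_nonneg _).trans (hdec 0)
    simpa using h0
  have hε : 0 ≤ ε := by
    have h0 := (norm_nonneg _).trans (hdef 0)
    simpa using h0
  have hTI : HasTypeIDecay C u := by
    intro t ht x
    have hσ : 0 < Real.sqrt (-t) := Real.sqrt_pos.2 (by linarith)
    have hσne : Real.sqrt (-t) ≠ 0 := hσ.ne'
    have hΛpos : 0 < (Real.sqrt (-t))⁻¹ := inv_pos.2 hσ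
    have hux : u t x = (Real.sqrt (-t))⁻¹ • U ((Real.sqrt (-t))⁻¹ • x) := by
      show lerayBackward (1 / 2 : ℝ) 0 U t x = _
      rw [lerayBackward_apply, scale_half_zero]
    rw [hux, norm_smul, Real.norm_eq_abs, abs_of_pos hΛpos]
    have h1 := hdec ((Real.sqrt (-t))⁻¹ • x)
    rw [norm_smul, Real.norm_eq_abs, abs_of_pos hΛpos] at h1
    calc (Real.sqrt (-t))⁻¹ * ‖U ((Real.sqrt (-t))⁻¹ • x)‖
        ≤ (Real.sqrt (-t))⁻¹ * (C / ((Real.sqrt (-t))⁻¹ * ‖x‖ + 1)) :=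
          mul_le_mul_of_nonneg_left h1 hΛpos.le
      _ = C / (‖x‖ + Real.sqrt (-t)) := by
          field_simp
  -- the scale-invariant defect bound, with the same `ε`
  have hdb : HasDefectBound ε d := by
    intro t ht x
    have hσ : 0 < Real.sqrt (-t) := Real.sqrt_pos.2 (by linarith)
    have hσne : Real.sqrt (-t) ≠ 0 := hσ.ne'
    have hΛpos : 0 < (Real.sqrt (-t))⁻¹ := inv_pos.2 hσ
    have hdx : d t x = ((Real.sqrt (-t))⁻¹) ^ 3 • D ((Real.sqrt (-t))⁻¹ • x) := by
      simp only [hddef, scale_half_zero]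
    rw [hdx, norm_smul, Real.norm_eq_abs, abs_of_pos (pow_pos hΛpos 3)]
    have h1 := hdef ((Real.sqrt (-t))⁻¹ • x)
    rw [norm_smul, Real.norm_eq_abs, abs_of_pos hΛpos] at h1
    calc (Real.sqrt (-t))⁻¹ ^ 3 * ‖D ((Real.sqrt (-t))⁻¹ • x)‖
        ≤ (Real.sqrt (-t))⁻¹ ^ 3 * (ε / ((Real.sqrt (-t))⁻¹ * ‖x‖ + 1) ^ 3) :=
          mul_le_mul_of_nonneg_left h1 (pow_pos hΛpos 3).le
      _ = ε / (‖x‖ + Real.sqrt (-t)) ^ 3 := by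
          field_simp
  -- the floor at `t = −1`
  have hu1 : u (-1) = U := by
    have h := lerayBackward_apply_sub_inv ha 0 U
    norm_num at h
    exact h
  have hamp' : ∃ x, δ ≤ ‖u (-1) x‖ := by
    rw [hu1]; exact hamp
  exact ⟨⟨⟨hcl, hbl, hcb⟩, hc, hdss, hTI⟩, hcmin, hcmax, hamp', hdb⟩

end Summit.NavierStokesRegularity.AngularGalerkinLadderLerayLine

end
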